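import Literature.Probability.RandomPlanarGeometry.SAWEndpointRateLowerInsertion
import Literature.Probability.RandomPlanarGeometry.SAWEndpointRateUpper
import Mathlib.Analysis.SpecialFunctions.Pow.Real
import HarnessLib

/-!
# An abstract ONE-STEP Kesten rate engine, insertion form: `−K N^{-1/3} ≤ S_{N+1}/S_N − μ ≤ K N^{-1/4}`

Topic `Literature/Probability/RandomPlanarGeometry` (lane «pcv-sawmu»; the engine behind the one-step fixed-endpoint and
polygon ratio RATES on the triangular lattice — `SAWTriangularEndpointRatioRate.lean` and the lane's polygon line; text:
a-idea-1 gen 13, `Sketch_G13_R83.lean` §2, carried verbatim).  Source: N. Madras, G. Slade, *The Self-Avoiding Walk*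
(1993), §7.5 eq. (7.5.2) p. 255 (Kesten's 1963 rate `−K N^{-1/3} < c_{N+2}(0,x)/c_N(0,x) − μ² < K N^{-1/4}` on `ℤ^d`, two
steps) and Lemma 7.3.1 p. 242; H. Kesten, *On the number of self-avoiding walks*, J. Math. Phys. 4 (1963) 960–969.

The statement is lattice-free.  A positive sequence `S` with (from a threshold `n₀ ≥ 1`) one-step monotonicity up to a
constant (`S_n ≤ A S_{n+1}`), Kesten's inequality in product form (`φ_n² − D/n ≤ φ_n φ_{n+1}`, `φ_n = S_{n+1}/S_n`), the
two envelopes `e^{−c√n} μ^n ≤ S_n ≤ e^{C√n} μ^n`, and an INSERTION inequality `S_n T_m ≤ P (n+m)^6 S_{n+m}` against an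
auxiliary sequence `T` with lower envelope `e^{−c√m} μ^m` (both from a threshold `m₀`), satisfies
`−K N^{-1/3} ≤ S_{N+1}/S_N − μ ≤ K N^{-1/4}` for `N ≥ N₀`.  Proof: the tree's TWO-step abstract lemmas
`Zd.KestenRateLower.lower_rate_cubeRoot_ins` and `Zd.KestenRateUpper.upper_rate_fourthRoot` applied to the doubled padded
sequence `a_k := w_{⌊k/2⌋}` (growth `√μ`), read at `k = 2N`.

## Main statement (namespace `Literature.Probability.RandomPlanarGeometry.SAW.OneStepRate`)

* `le_pow_mul_of_mono` — `S_n ≤ A^M S_{n+M}`;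
* **`oneStepRatioRate_insertion`** — the engine.
-/

noncomputable section

open Filter Topology Finset

namespace Literature.Probability.RandomPlanarGeometry.SAW.OneStepRate

section Engine

variable {S T : ℕ → ℝ} {μ A P D c C : ℝ} {n₀ m₀ : ℕ}

/-- Iterated one-step monotonicity: `S_n ≤ A^M S_{n+M}` for `n ≥ n₀`. [cite: MadrasSlade1993, Lemma 7.3.3 and Lemma 7.3.1 (ii)] -/
theorem le_pow_mul_of_mono (hA : 0 ≤ A) (hmono : ∀ n : ℕ, n₀ ≤ n → S n ≤ A * S (n + 1)) {n : ℕ}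
    (hn : n₀ ≤ n) (M : ℕ) : S n ≤ A ^ M * S (n + M) := by
  induction M with
  | zero => simp
  | succ M ih =>
    calc S n ≤ A ^ M * S (n + M) := ih
      _ ≤ A ^ M * (A * S (n + M + 1)) :=
          mul_le_mul_of_nonneg_left (hmono _ (by omega)) (pow_nonneg hA _)
      _ = A ^ (M + 1) * S (n + (M + 1)) := by rw [pow_succ, mul_assoc, Nat.add_assoc]

set_option maxHeartbeats 400000 in
/-- **One-step mixed Kesten rate, insertion form (abstract).**  `S` positive with ratio `≥ 1/A`, product-form
Kesten inequality, envelopes `e^{∓c√n} μ^n`-close (all from a threshold `n₀ ≥ 1`), and the insertion inequality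
`S_n T_m ≤ P (n+m)^6 S_{n+m}` against an auxiliary sequence `T` with lower envelope `e^{-c√m} μ^m` (both from any `m₀`):
then `-K N^{-1/3} ≤ S_{N+1}/S_N - μ ≤ K N^{-1/4}` for `N ≥ N₀`.  Proof: the tree's two-step abstract lemmas
`Zd.KestenRateLower.lower_rate_cubeRoot_ins` and `Zd.KestenRateUpper.upper_rate_fourthRoot` applied to the DOUBLED
padded sequence `a_k := w_{⌊k/2⌋}`, `w_j := S_j (j ≥ n₀), 1 (j < n₀)`, growth `ν := √μ`, read at `k = 2N`.
[cite: MadrasSlade1993, §7.5 eq. (7.5.2) (p. 255) and Lemma 7.3.1 (p. 242)] [cite: Kesten1963SAW, Theorem 2] -/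
theorem oneStepRatioRate_insertion (hμ : 1 ≤ μ) (hA : 1 ≤ A) (hP : 1 ≤ P) (hc : 0 ≤ c) (hC : 0 ≤ C)
    (hn₀ : 1 ≤ n₀)
    (hmono : ∀ n : ℕ, n₀ ≤ n → S n ≤ A * S (n + 1))
    (hK : ∀ n : ℕ, n₀ ≤ n → (S (n + 1) / S n) ^ 2 - D / n ≤ (S (n + 1) / S n) * (S (n + 2) / S (n + 1)))
    (hlo : ∀ n : ℕ, n₀ ≤ n → Real.exp (-(c * Real.sqrt n)) * μ ^ n ≤ S n)
    (hhi : ∀ n : ℕ, n₀ ≤ n → S n ≤ Real.exp (C * Real.sqrt n) * μ ^ n)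
    (hins : ∀ n m : ℕ, n₀ ≤ n → m₀ ≤ m → S n * T m ≤ P * ((n : ℝ) + m) ^ 6 * S (n + m))
    (hT : ∀ m : ℕ, m₀ ≤ m → Real.exp (-(c * Real.sqrt m)) * μ ^ m ≤ T m) :
    ∃ K : ℝ, ∃ N₀ : ℕ, ∀ N : ℕ, N₀ ≤ N →
      -(K * (N : ℝ) ^ (-(1 : ℝ) / 3)) ≤ S (N + 1) / S N - μ ∧
        S (N + 1) / S N - μ ≤ K * (N : ℝ) ^ (-(1 : ℝ) / 4) := by
  have hμ0 : 0 < μ := by linarith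
  have hA0 : 0 < A := by linarith
  have hP0 : 0 < P := by linarith
  have hSpos : ∀ n, n₀ ≤ n → 0 < S n := fun n hn => lt_of_lt_of_le (by positivity) (hlo n hn)
  have hTpos : ∀ m, m₀ ≤ m → 0 < T m := fun m hm => lt_of_lt_of_le (by positivity) (hT m hm)
  -- the ratio is `≥ 1/A`, and the B-form of Kesten's inequality
  have hφA : ∀ n, n₀ ≤ n → A⁻¹ ≤ S (n + 1) / S n := by
    intro n hn
    rw [le_div_iff₀ (hSpos n hn), inv_mul_le_iff₀ hA0]
    exact hmono n hn
  have hBform : ∀ n, n₀ ≤ n → S (n + 1) / S n - A * |D| / n ≤ S (n + 2) / S (n + 1) := by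
    intro n hn
    have hn1 : (1 : ℝ) ≤ n := by exact_mod_cast le_trans hn₀ hn
    have hn0 : (0 : ℝ) < n := by linarith
    set φ := S (n + 1) / S n with hφdef
    set ψ := S (n + 2) / S (n + 1) with hψdef
    have hφ0 : 0 < φ := div_pos (hSpos _ (by omega)) (hSpos _ hn)
    have hAφ : 1 ≤ A * φ := by
      have := mul_le_mul_of_nonneg_left (hφA n hn) hA0.le
      rwa [mul_inv_cancel₀ hA0.ne'] at this
    have h := hK n hn
    have h1 : φ - D / (n * φ) ≤ ψ := by
      have e : φ * (φ - D / (n * φ)) = φ ^ 2 - D / n := by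
        field_simp
      have : φ * (φ - D / (n * φ)) ≤ φ * ψ := by rw [e]; exact h
      exact le_of_mul_le_mul_left this hφ0
    have h2 : D / (n * φ) ≤ A * |D| / n := by
      rw [div_le_div_iff₀ (by positivity) hn0]
      have hDn : 0 ≤ |D| * n := by positivity
      nlinarith [le_abs_self D, hDn, hAφ]
    linarith
  -- the square root of the growth constant
  set ν := Real.sqrt μ with hνdef
  have hν1 : 1 ≤ ν := by
    rw [hνdef, show (1 : ℝ) = Real.sqrt 1 by simp]
    exact Real.sqrt_le_sqrt hμ
  have hν0 : 0 < ν := by linarith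
  have hν2 : ν ^ 2 = μ := by rw [hνdef]; exact Real.sq_sqrt hμ0.le
  have hνpow : ∀ j : ℕ, ν ^ (2 * j) = μ ^ j := fun j => by rw [pow_mul, hν2]
  have hlogν : 0 ≤ Real.log ν := Real.log_nonneg hν1
  -- the padded sequence `w` and its doubling `a`
  set w : ℕ → ℝ := fun j => if j < n₀ then 1 else S j with hwdef
  have hw_lt : ∀ j, j < n₀ → w j = 1 := fun j hj => by simp [hwdef, hj]
  have hw_ge : ∀ j, n₀ ≤ j → w j = S j := fun j hj => by simp [hwdef, not_lt.2 hj]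
  have hwpos : ∀ j, 0 < w j := by
    intro j
    by_cases hj : j < n₀
    · rw [hw_lt j hj]; exact one_pos
    · rw [hw_ge j (not_lt.1 hj)]; exact hSpos j (not_lt.1 hj)
  set a : ℕ → ℝ := fun k => w (k / 2) with hadef
  have ha0 : ∀ k, a k = w (k / 2) := fun k => rfl
  have ha2 : ∀ k, a (k + 2) = w (k / 2 + 1) := fun k => by rw [ha0]; congr 1; omega
  have ha4 : ∀ k, a (k + 4) = w (k / 2 + 2) := fun k => by rw [ha0]; congr 1; omega
  have hapos : ∀ k, 0 < a k := fun k => hwpos _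
  -- Kesten's inequality, B-form, for the doubled sequence and ALL `k ≥ 1`
  have hSn₀ := hSpos n₀ le_rfl
  set B : ℝ := 3 * A * |D| + (2 * n₀ + 1) * (1 + S n₀) + μ + 1 with hBdef
  have hB3 : 3 * A * |D| ≤ B := by
    have : (0 : ℝ) ≤ (2 * n₀ + 1) * (1 + S n₀) := by positivity
    linarith
  have hBn : (2 * (n₀ : ℝ) + 1) * (1 + S n₀) ≤ B := by
    have : (0 : ℝ) ≤ 3 * A * |D| := by positivity
    linarith
  have hB1 : 1 ≤ B := by
    have : (0 : ℝ) ≤ 3 * A * |D| := by positivity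
    have : (0 : ℝ) ≤ (2 * n₀ + 1) * (1 + S n₀) := by positivity
    linarith
  have hBμ : ν ^ 2 ≤ B := by
    rw [hν2]
    have : (0 : ℝ) ≤ 3 * A * |D| := by positivity
    have : (0 : ℝ) ≤ (2 * n₀ + 1) * (1 + S n₀) := by positivity
    linarith
  have hKa : ∀ k : ℕ, 1 ≤ k → a (k + 2) / a k - B / k ≤ a (k + 4) / a (k + 2) := by
    intro k hk
    rw [ha2, ha4, ha0]
    set j := k / 2 with hjdef
    have hkj : 2 * j ≤ k ∧ k ≤ 2 * j + 1 := by omega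
    have hk0 : (0 : ℝ) < k := by exact_mod_cast hk
    have hkr : (k : ℝ) ≤ 2 * j + 1 := by exact_mod_cast hkj.2
    rcases lt_trichotomy (j + 1) n₀ with hlt | heq | hgt
    · -- deep in the padding: `1 - B/k ≤ w_{j+2}`
      rw [hw_lt j (by omega), hw_lt (j + 1) hlt, div_one, div_one]
      have hBk : 1 ≤ B / k := by
        rw [le_div_iff₀ hk0]
        have : (k : ℝ) ≤ 2 * n₀ + 1 := by exact_mod_cast (by omega : k ≤ 2 * n₀ + 1)
        nlinarith [hSn₀.le]
      linarith [hwpos (j + 2)]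
    · -- the seam: `S_{n₀} - B/k ≤ S_{n₀+1}/S_{n₀}`
      have hj : j = n₀ - 1 := by omega
      rw [hw_lt j (by omega), hw_ge (j + 1) (by omega), hw_ge (j + 2) (by omega), div_one,
        show j + 1 = n₀ from heq, show j + 2 = n₀ + 1 by omega]
      have hR : 0 < S (n₀ + 1) / S n₀ := div_pos (hSpos _ (by omega)) hSn₀
      have hBk : 1 + S n₀ ≤ B / k := by
        rw [le_div_iff₀ hk0]
        have hk' : (k : ℝ) ≤ 2 * n₀ + 1 := by exact_mod_cast (by omega : k ≤ 2 * n₀ + 1)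
        have : (1 + S n₀) * k ≤ (1 + S n₀) * (2 * n₀ + 1) :=
          mul_le_mul_of_nonneg_left hk' (by linarith [hSn₀.le])
        linarith
      linarith
    · -- the real region: B-form with `A|D|/j ≤ 3A|D|/k`
      have hjn : n₀ ≤ j := by omega
      rw [hw_ge j hjn, hw_ge (j + 1) (by omega), hw_ge (j + 2) (by omega)]
      have hj1 : (1 : ℝ) ≤ j := by exact_mod_cast le_trans hn₀ hjn
      have hkj3 : (k : ℝ) ≤ 3 * j := by linarith
      have h1 := hBform j hjn
      have h2 : A * |D| / j ≤ B / k := by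
        rw [div_le_div_iff₀ (by linarith) hk0]
        have hAD : 0 ≤ A * |D| := by positivity
        nlinarith [hB3, hAD, hk0]
      linarith
  -- lower envelope of `a`, all `k`
  set c' : ℝ := c + Real.log ν + Real.sqrt (2 * n₀) * Real.log ν with hc'def
  have hc' : 0 ≤ c' := by
    have : 0 ≤ Real.sqrt (2 * n₀) * Real.log ν := by positivity
    rw [hc'def]; linarith
  have hloa : ∀ k : ℕ, Real.exp (-(c' * Real.sqrt k)) * ν ^ k ≤ a k := by
    intro k
    rw [ha0]
    set j := k / 2 with hjdef
    have hkj : 2 * j ≤ k ∧ k ≤ 2 * j + 1 := by omega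
    have hsk : 0 ≤ Real.sqrt k := Real.sqrt_nonneg _
    by_cases hj : j < n₀
    · -- padding: `e^{-c'√k} ν^k ≤ 1` since `k log ν ≤ √(2n₀) log ν √k ≤ c' √k`
      rw [hw_lt j hj]
      have hk2 : (k : ℝ) ≤ 2 * n₀ := by exact_mod_cast (by omega : k ≤ 2 * n₀)
      have hsk2 : Real.sqrt k ≤ Real.sqrt (2 * n₀) := Real.sqrt_le_sqrt hk2
      have hexp : ν ^ k = Real.exp (k * Real.log ν) := by
        rw [← Real.log_pow, Real.exp_log (pow_pos hν0 _)]
      rw [hexp, ← Real.exp_add]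
      apply Real.exp_le_one_iff.2
      have : (k : ℝ) * Real.log ν ≤ c' * Real.sqrt k := by
        have h0 : (k : ℝ) * Real.log ν = Real.sqrt k * Real.sqrt k * Real.log ν := by
          rw [Real.mul_self_sqrt (Nat.cast_nonneg k)]
        have h1 : Real.sqrt k * Real.sqrt k * Real.log ν ≤ Real.sqrt (2 * n₀) * Real.sqrt k * Real.log ν :=
          mul_le_mul_of_nonneg_right (mul_le_mul_of_nonneg_right hsk2 hsk) hlogν
        have h2 : Real.sqrt (2 * n₀) * Real.sqrt k * Real.log ν ≤ c' * Real.sqrt k := by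
          have : Real.sqrt (2 * n₀) * Real.log ν ≤ c' := by
            rw [hc'def]; nlinarith [hlogν, hc]
          nlinarith [hsk, this]
        linarith
      linarith
    · -- real region: `e^{-c'√k} ν^k ≤ e^{-c√j} ν^{2j} ≤ S_j`
      have hjn : n₀ ≤ j := not_lt.1 hj
      rw [hw_ge j hjn]
      refine le_trans ?_ (hlo j hjn)
      rw [← hνpow]
      have hk1 : (1 : ℝ) ≤ k := by exact_mod_cast (by omega : 1 ≤ k)
      have hs1 : 1 ≤ Real.sqrt k := by
        rw [show (1 : ℝ) = Real.sqrt 1 by simp]; exact Real.sqrt_le_sqrt hk1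
      have hsj : Real.sqrt j ≤ Real.sqrt k := Real.sqrt_le_sqrt (by exact_mod_cast (by omega : j ≤ k))
      have hsj0 : 0 ≤ Real.sqrt j := Real.sqrt_nonneg _
      -- `ν^k ≤ ν · ν^{2j}` and `e^{-c'√k} ν ≤ e^{-c√j}`
      have hp : ν ^ k ≤ ν ^ (2 * j) * ν := by
        rw [← pow_succ]; exact pow_le_pow_right₀ hν1 (by omega)
      have hνe : ν = Real.exp (Real.log ν) := (Real.exp_log hν0).symm
      have key : Real.exp (-(c' * Real.sqrt k)) * ν ≤ Real.exp (-(c * Real.sqrt j)) := by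
        rw [hνe, ← Real.exp_add, Real.exp_le_exp]
        have : c * Real.sqrt j + Real.log ν ≤ c' * Real.sqrt k := by
          have h1 : c * Real.sqrt j ≤ c * Real.sqrt k := mul_le_mul_of_nonneg_left hsj hc
          have h2 : Real.log ν ≤ Real.log ν * Real.sqrt k := le_mul_of_one_le_right hlogν hs1
          have h3 : 0 ≤ Real.sqrt (2 * n₀) * Real.log ν * Real.sqrt k := by positivity
          rw [hc'def]
          nlinarith
        linarith
      calc Real.exp (-(c' * Real.sqrt k)) * ν ^ k
          ≤ Real.exp (-(c' * Real.sqrt k)) * (ν ^ (2 * j) * ν) :=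
            mul_le_mul_of_nonneg_left hp (Real.exp_pos _).le
        _ = (Real.exp (-(c' * Real.sqrt k)) * ν) * ν ^ (2 * j) := by ring
        _ ≤ Real.exp (-(c * Real.sqrt j)) * ν ^ (2 * j) :=
            mul_le_mul_of_nonneg_right key (pow_nonneg hν0.le _)
  -- upper envelope of `a`, all `k`
  have hhia : ∀ k : ℕ, a k ≤ Real.exp (C * Real.sqrt ((k : ℝ) + 1)) * ν ^ k := by
    intro k
    rw [ha0]
    set j := k / 2 with hjdef
    have hkj : 2 * j ≤ k ∧ k ≤ 2 * j + 1 := by omega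
    have h1 : 1 ≤ Real.exp (C * Real.sqrt ((k : ℝ) + 1)) := Real.one_le_exp (by positivity)
    by_cases hj : j < n₀
    · rw [hw_lt j hj]
      exact le_trans h1 (le_mul_of_one_le_right (by positivity) (one_le_pow₀ hν1))
    · have hjn : n₀ ≤ j := not_lt.1 hj
      rw [hw_ge j hjn]
      refine (hhi j hjn).trans ?_
      rw [← hνpow]
      have hsj : Real.sqrt j ≤ Real.sqrt ((k : ℝ) + 1) :=
        Real.sqrt_le_sqrt (by exact_mod_cast (by omega : j ≤ k + 1))
      exact mul_le_mul (Real.exp_le_exp.2 (mul_le_mul_of_nonneg_left hsj hC))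
        (pow_le_pow_right₀ hν1 hkj.1) (pow_nonneg hν0.le _) (Real.exp_pos _).le
  -- THE UPPER RATE (tree, two-step `1/4` lemma) for `a`
  obtain ⟨K₁, hK₁⟩ := Zd.KestenRateUpper.upper_rate_fourthRoot hapos hν1 hB1 hc' hC hKa hloa hhia
  -- the auxiliary sequence for the insertion lemma
  set e : ℕ → ℝ := fun M => if M < m₀ then (A⁻¹) ^ M else T M / P with hedef
  have he_lt : ∀ M, M < m₀ → e M = (A⁻¹) ^ M := fun M hM => by simp [hedef, hM]
  have he_ge : ∀ M, m₀ ≤ M → e M = T M / P := fun M hM => by simp [hedef, not_lt.2 hM]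
  set Ae : ℝ := P * (A * μ) ^ m₀ with hAedef
  have hAμ1 : 1 ≤ A * μ := one_le_mul_of_one_le_of_one_le hA hμ
  have hAμm : 1 ≤ (A * μ) ^ m₀ := one_le_pow₀ hAμ1
  have hAe : 1 ≤ Ae := by rw [hAedef]; exact one_le_mul_of_one_le_of_one_le hP hAμm
  have hloe : ∀ M : ℕ, 2 ≤ M → Real.exp (-(c * Real.sqrt M)) * ν ^ (2 * M) ≤ Ae * e M := by
    intro M hM
    rw [hνpow]
    have hexp1 : Real.exp (-(c * Real.sqrt M)) ≤ 1 :=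
      Real.exp_le_one_iff.2 (by have := Real.sqrt_nonneg (M : ℝ); nlinarith)
    have hμM : 0 ≤ μ ^ M := pow_nonneg hμ0.le _
    by_cases hMm : M < m₀
    · rw [he_lt M hMm, hAedef]
      -- `e^{-c√M} μ^M ≤ μ^M = (Aμ)^M (A⁻¹)^M ≤ P (Aμ)^{m₀} (A⁻¹)^M`
      have h1 : Real.exp (-(c * Real.sqrt M)) * μ ^ M ≤ μ ^ M := by
        have := mul_le_mul_of_nonneg_right hexp1 hμM; rwa [one_mul] at this
      have h2 : μ ^ M = (A * μ) ^ M * (A⁻¹) ^ M := by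
        rw [mul_pow, mul_assoc, mul_comm (μ ^ M), ← mul_assoc, ← mul_pow, mul_inv_cancel₀ hA0.ne', one_pow,
          one_mul]
      have h3 : (A * μ) ^ M * (A⁻¹) ^ M ≤ P * (A * μ) ^ m₀ * (A⁻¹) ^ M := by
        have hAi : 0 ≤ (A⁻¹) ^ M := pow_nonneg (inv_nonneg.2 hA0.le) _
        have : (A * μ) ^ M ≤ P * (A * μ) ^ m₀ :=
          le_trans (pow_le_pow_right₀ hAμ1 hMm.le) (le_mul_of_one_le_left (by positivity) hP)
        exact mul_le_mul_of_nonneg_right this hAi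
      linarith [h2 ▸ h3]
    · have hMm' : m₀ ≤ M := not_lt.1 hMm
      rw [he_ge M hMm', hAedef]
      have hT' := hT M hMm'
      have e1 : P * (A * μ) ^ m₀ * (T M / P) = (A * μ) ^ m₀ * T M := by
        field_simp
      rw [e1]
      exact hT'.trans (le_mul_of_one_le_left (hTpos M hMm').le hAμm)
  -- the insertion inequality for the doubled sequence (even indices)
  have hSMa : ∀ N' M : ℕ, 2 * n₀ ≤ N' → N' % 2 = 0 → 2 ≤ M →
      a N' * e M ≤ (2 * ((N' : ℝ) + 2 * M) + 3) ^ 6 * a (N' + 2 * M) := by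
    intro N' M hN' hpar hM
    rw [ha0, ha0]
    set j := N' / 2 with hjdef
    have hN'j : N' = 2 * j := by omega
    have hjn : n₀ ≤ j := by omega
    have hjM : (N' + 2 * M) / 2 = j + M := by omega
    rw [hjM, hw_ge j hjn, hw_ge (j + M) (by omega)]
    have hpoly1 : (1 : ℝ) ≤ (2 * ((N' : ℝ) + 2 * M) + 3) ^ 6 :=
      one_le_pow₀ (by have : (0 : ℝ) ≤ (N' : ℝ) + 2 * M := by positivity
                      linarith)
    have hSjM := hSpos (j + M) (by omega)
    by_cases hMm : M < m₀
    · rw [he_lt M hMm]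
      -- `S_j A^{-M} ≤ S_{j+M}`
      have h1 := le_pow_mul_of_mono hA0.le hmono hjn M
      have hAM : 0 < A ^ M := pow_pos hA0 _
      have h2 : S j * (A⁻¹) ^ M ≤ S (j + M) := by
        rw [inv_pow, ← div_eq_mul_inv, div_le_iff₀ hAM]
        linarith [mul_comm (A ^ M) (S (j + M))]
      exact h2.trans (le_mul_of_one_le_left hSjM.le hpoly1)
    · have hMm' : m₀ ≤ M := not_lt.1 hMm
      rw [he_ge M hMm']
      have h1 := hins j M hjn hMm'
      have h2 : S j * (T M / P) ≤ ((j : ℝ) + M) ^ 6 * S (j + M) := by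
        rw [mul_div_assoc', div_le_iff₀ hP0]
        linarith [mul_comm (((j : ℝ) + M) ^ 6 * S (j + M)) P]
      refine h2.trans (mul_le_mul_of_nonneg_right ?_ hSjM.le)
      have hjr : ((j : ℝ) + M) ≤ 2 * ((N' : ℝ) + 2 * M) + 3 := by
        have : (N' : ℝ) = 2 * j := by exact_mod_cast hN'j
        have hM0 : (0 : ℝ) ≤ M := Nat.cast_nonneg _
        have hj0 : (0 : ℝ) ≤ j := Nat.cast_nonneg _
        linarith
      exact pow_le_pow_left₀ (by positivity) hjr 6
  -- THE LOWER RATE (tree, two-step `1/3` lemma, insertion form) for `a`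
  obtain ⟨K₂, hK₂⟩ := Zd.KestenRateLower.lower_rate_cubeRoot_ins (r := 0) hapos hν1 hB1 hBμ hc hAe hKa hloe hSMa
  -- read both at `k = 2N`
  set K : ℝ := max (max K₁ K₂) 0 with hKdef
  have hK0 : 0 ≤ K := le_max_right _ _
  have hK1K : K₁ ≤ K := le_trans (le_max_left _ _) (le_max_left _ _)
  have hK2K : K₂ ≤ K := le_trans (le_max_right _ _) (le_max_left _ _)
  refine ⟨K, 2 * n₀ + 1, fun N hN => ?_⟩
  have hNn : n₀ ≤ N := by omega
  have hN1 : 1 ≤ N := by omega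
  have hNr : (0 : ℝ) < N := by exact_mod_cast (by omega : 0 < N)
  have hNr1 : (1 : ℝ) ≤ N := by exact_mod_cast hN1
  have hratio : a (2 * N + 2) / a (2 * N) = S (N + 1) / S N := by
    rw [ha0, ha0, show (2 * N + 2) / 2 = N + 1 by omega, show 2 * N / 2 = N by omega, hw_ge N hNn,
      hw_ge (N + 1) (by omega)]
  -- `(2N)^{-e} ≤ N^{-e}`
  have hmon : ∀ e : ℝ, 0 ≤ e → ((2 * N : ℕ) : ℝ) ^ (-e) ≤ (N : ℝ) ^ (-e) := by
    intro e he
    have h2N : (N : ℝ) ≤ ((2 * N : ℕ) : ℝ) := by exact_mod_cast (by omega : N ≤ 2 * N)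
    exact Real.rpow_le_rpow_of_nonpos hNr h2N (by linarith)
  set φ := S (N + 1) / S N with hφdef
  constructor
  · -- lower side
    by_cases hle : μ ≤ φ
    · have : 0 ≤ K * (N : ℝ) ^ (-(1 : ℝ) / 3) := by positivity
      linarith
    · have hu : 0 < μ - φ := by linarith
      have hdev : a (2 * N + 2) / a (2 * N) ≤ ν ^ 2 - (μ - φ) := by rw [hratio, hν2]; linarith
      have h := hK₂ (2 * N) (by omega) (by omega) (μ - φ) hu hdev
      have h' : μ - φ ≤ K * (N : ℝ) ^ (-(1 : ℝ) / 3) := by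
        refine h.trans ?_
        have hr0 : 0 ≤ ((2 * N : ℕ) : ℝ) ^ (-(1 : ℝ) / 3) := by positivity
        have hm := hmon (1 / 3) (by norm_num)
        rw [show -((1 : ℝ) / 3) = -(1 : ℝ) / 3 by ring] at hm
        calc K₂ * ((2 * N : ℕ) : ℝ) ^ (-(1 : ℝ) / 3) ≤ K * ((2 * N : ℕ) : ℝ) ^ (-(1 : ℝ) / 3) :=
              mul_le_mul_of_nonneg_right hK2K hr0
          _ ≤ K * (N : ℝ) ^ (-(1 : ℝ) / 3) := mul_le_mul_of_nonneg_left hm hK0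
      linarith
  · -- upper side
    by_cases hle : φ ≤ μ
    · have : 0 ≤ K * (N : ℝ) ^ (-(1 : ℝ) / 4) := by positivity
      linarith
    · have hu : 0 < φ - μ := by linarith
      have hdev : ν ^ 2 + (φ - μ) ≤ a (2 * N + 2) / a (2 * N) := by rw [hratio, hν2]; linarith
      have h := hK₁ (2 * N) (by omega) (φ - μ) hu hdev
      refine h.trans ?_
      have hr0 : 0 ≤ ((2 * N : ℕ) : ℝ) ^ (-(1 : ℝ) / 4) := by positivity
      have hm := hmon (1 / 4) (by norm_num)
      rw [show -((1 : ℝ) / 4) = -(1 : ℝ) / 4 by ring] at hm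
      calc K₁ * ((2 * N : ℕ) : ℝ) ^ (-(1 : ℝ) / 4) ≤ K * ((2 * N : ℕ) : ℝ) ^ (-(1 : ℝ) / 4) :=
            mul_le_mul_of_nonneg_right hK1K hr0
        _ ≤ K * (N : ℝ) ^ (-(1 : ℝ) / 4) := mul_le_mul_of_nonneg_left hm hK0

end Engine

end Literature.Probability.RandomPlanarGeometry.SAW.OneStepRate
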